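import Mathlib
import Literature.NumberTheory.LFunctions.Zhang2022.Section4GaussianWeight
import HarnessLib

/-!
# Zhang (2022), §11: integrals of the Gaussian-smoothed step `z ↦ g(e^{Kz}/y)` over intervals

Topic `Literature/NumberTheory/LFunctions/Zhang2022` (Landau–Siegel audit tree; verdict-neutral).
Y. Zhang, *Discrete mean estimates and the Landau–Siegel zero*, arXiv:2211.02515v1 (2022)
[Zhang2022LandauSiegel], §11 proof of Lemma 11.1, PDF pp. 63–64, tex L3238–L3289 — the real
analysis behind (11.2)–(11.3), made uniform and kernel-checked; it is the toolbox from which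
`Section11Lemma111` proves the printed Lemma 11.1. Everything here is about the tree's weight
`g = GaussWeight.gWeight Λ` ((4.1); the source has `Λ = 𝓛³⁰`) composed with `z ↦ e^{Kz}/y`
(the source has `K = log P`, so `e^{Kz}/y = P^z/y`); no character, `L`-function or named fact occurs.

Write `u = log y/K` and `φ(z) = g(e^{Kz}/y) = g(e^{Kz − log y})`: an increasing smoothed Heaviside
step at `z = u` with `0 < φ < 1`, Gaussian majorant `γ(z) = ½exp{−Λ(Kz − log y)²}`:

* (4.2)/(4.3) along the step: `0 ≤ 1 − φ(z) ≤ γ(z)` for `z ≥ u`, `0 ≤ φ(z) ≤ γ(z)` for `z ≤ u`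
  (`one_sub_step_bounds`, `step_le_majorant`);
* (11.4) along the step: `φ(z) + φ(2u − z) = 1`, whence **`∫_{u−δ}^{u+δ} φ = δ` exactly**
  (`step_add_step_reflect`, `integral_step_symm`) — the source's "By (11.4),
  `∫_{0.502}^{2u−0.502} g(P^z/y)dz = u − 0.502`";
* position lemmas for `∫_a^b φ`: right of `u` it is `(b − a) − O(∫γ)`, left of `u` it is `O(∫γ)`
  (`integral_right_bounds`, `integral_left_bounds`); with a margin `δ` these become
  `(b−a)·½e^{−Λ(Kδ)²}`-bounds (`integral_step_middle`, `integral_step_right_far`,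
  `integral_step_left_far`) — the source's "by (6.2) … = 1.006 − 2u + O(ε)", "by (6.3) … ≪ ε";
* the uniform bound `|∫_a^b φ − (b − clamp(u;a,b))| ≤ ½√(π/(ΛK²))` in every position
  (`integral_step_crude`, via `∫_ℝ e^{−ΛK²w²}dw = √(π/(ΛK²))`), which yields (11.3) with room.

## References

* Y. Zhang, arXiv:2211.02515v1 (2022), §11 pp. 63–64, (11.4); §4 (4.1)–(4.3).
  [cite: Zhang2022LandauSiegel, §11 Lemma 11.1 proof]
-/

noncomputable section

open Real Set MeasureTheory Filter

namespace Literature.NumberTheory.LFunctions.Zhang2022.SmoothedStep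

open GaussWeight

variable {Λ K y : ℝ}

/-! ## §1. The step and its majorant, pointwise -/

/-- `log(e^{Kz}/y) = Kz − log y`. [folklore] -/
private theorem log_arg (hy : 0 < y) (z : ℝ) : Real.log (Real.exp (K * z) / y) = K * z - Real.log y := by
  rw [Real.log_div (Real.exp_pos _).ne' hy.ne', Real.log_exp]

/-- `e^{K·(log y/K)} = y`. [folklore] -/
private theorem exp_mul_div (hK : K ≠ 0) (hy : 0 < y) : Real.exp (K * (Real.log y / K)) = y := by
  rw [mul_div_cancel₀ _ hK, Real.exp_log hy]

/-- The step `z ↦ g(e^{Kz}/y)` is increasing (`K ≥ 0`). [cite: Zhang2022LandauSiegel, §4 after (4.1)] -/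
theorem step_monotone (hΛ : 0 < Λ) (hK : 0 ≤ K) (hy : 0 < y) :
    Monotone (fun z : ℝ => gWeight Λ (Real.exp (K * z) / y)) := by
  intro z₁ z₂ h
  have h1 : Real.exp (K * z₁) / y ≤ Real.exp (K * z₂) / y := by gcongr
  exact gWeight_mono hΛ (div_pos (Real.exp_pos _) hy) h1

/-- The step is integrable on every interval (it is monotone).
[cite: Zhang2022LandauSiegel, §11 Lemma 11.1 proof p. 63] -/
theorem step_intervalIntegrable (hΛ : 0 < Λ) (hK : 0 ≤ K) (hy : 0 < y) (a b : ℝ) :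
    IntervalIntegrable (fun z : ℝ => gWeight Λ (Real.exp (K * z) / y)) volume a b :=
  (step_monotone hΛ hK hy).intervalIntegrable

/-- The majorant `γ(z) = ½exp{−Λ(Kz − log y)²}` is continuous. [folklore] -/
private theorem continuous_majorant :
    Continuous (fun z : ℝ => (1 / 2) * Real.exp (-Λ * (K * z - Real.log y) ^ 2)) := by
  fun_prop

/-- The majorant is integrable on every interval. [folklore] -/
private theorem majorant_intervalIntegrable (a b : ℝ) :
    IntervalIntegrable (fun z : ℝ => (1 / 2) * Real.exp (-Λ * (K * z - Real.log y) ^ 2))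
      volume a b :=
  continuous_majorant.intervalIntegrable a b

/-- **(4.2) along the step**: for `z ≥ u`, `0 ≤ 1 − φ(z) ≤ γ(z)`. [cite: Zhang2022LandauSiegel, §4 (4.2)] -/
theorem one_sub_step_bounds (hΛ : 0 < Λ) (hK : 0 < K) (hy : 0 < y) {z : ℝ}
    (hz : Real.log y / K ≤ z) :
    0 ≤ 1 - gWeight Λ (Real.exp (K * z) / y) ∧
      1 - gWeight Λ (Real.exp (K * z) / y) ≤ (1 / 2) * Real.exp (-Λ * (K * z - Real.log y) ^ 2) := by
  have hx : 1 ≤ Real.exp (K * z) / y := by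
    rw [le_div_iff₀ hy, one_mul, ← exp_mul_div hK.ne' hy]
    exact Real.exp_le_exp.mpr (mul_le_mul_of_nonneg_left hz hK.le)
  have h := one_sub_gWeight_le hΛ hx
  rw [log_arg hy] at h
  exact h

/-- **(4.3) along the step**: for `z ≤ u`, `φ(z) ≤ γ(z)`. [cite: Zhang2022LandauSiegel, §4 (4.3)] -/
theorem step_le_majorant (hΛ : 0 < Λ) (hK : 0 < K) (hy : 0 < y) {z : ℝ} (hz : z ≤ Real.log y / K) :
    gWeight Λ (Real.exp (K * z) / y) ≤ (1 / 2) * Real.exp (-Λ * (K * z - Real.log y) ^ 2) := by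
  have hx0 : 0 < Real.exp (K * z) / y := div_pos (Real.exp_pos _) hy
  have hx1 : Real.exp (K * z) / y ≤ 1 := by
    rw [div_le_one hy, ← exp_mul_div hK.ne' hy]
    exact Real.exp_le_exp.mpr (mul_le_mul_of_nonneg_left hz hK.le)
  have h := gWeight_le hΛ hx0 hx1
  rw [log_arg hy] at h
  exact h

/-- **(11.4)**: `g(x) + g(x⁻¹) = 1` (the Gaussian is even). [cite: Zhang2022LandauSiegel, §11 (11.4) p. 63] -/
theorem gWeight_add_gWeight_inv (hΛ : 0 < Λ) (x : ℝ) : gWeight Λ x + gWeight Λ x⁻¹ = 1 := by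
  rw [gWeight_eq_integral_Ioi (x := x⁻¹), Real.log_inv, neg_neg]
  exact gWeight_add_tail hΛ x

/-- **(11.4) along the step**: `φ(z) + φ(2u − z) = 1` (the two arguments of `g` are reciprocal).
[cite: Zhang2022LandauSiegel, §11 (11.4)] -/
theorem step_add_step_reflect (hΛ : 0 < Λ) (hK : K ≠ 0) (hy : 0 < y) (z : ℝ) :
    gWeight Λ (Real.exp (K * z) / y) + gWeight Λ (Real.exp (K * (2 * (Real.log y / K) - z)) / y) = 1 := by
  have hy' : y ≠ 0 := hy.ne'
  have hinv : Real.exp (K * (2 * (Real.log y / K) - z)) / y = (Real.exp (K * z) / y)⁻¹ := by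
    have h2 : K * (2 * (Real.log y / K) - z) = (Real.log y + Real.log y) - K * z := by
      rw [mul_sub, show K * (2 * (Real.log y / K)) = 2 * (K * (Real.log y / K)) by ring,
        mul_div_cancel₀ _ hK]
      ring
    rw [h2, Real.exp_sub, Real.exp_add, Real.exp_log hy, inv_div]
    field_simp
  rw [hinv]
  exact gWeight_add_gWeight_inv hΛ _

/-! ## §2. Integrals of the step over intervals -/

/-- **The symmetric window is exact**: `∫_{u−δ}^{u+δ} φ = δ` ("By (11.4)").
[cite: Zhang2022LandauSiegel, §11 p. 63] -/
theorem integral_step_symm (hΛ : 0 < Λ) (hK : 0 < K) (hy : 0 < y) (δ : ℝ) :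
    ∫ z in (Real.log y / K - δ)..(Real.log y / K + δ), gWeight Λ (Real.exp (K * z) / y) = δ := by
  have hint : IntervalIntegrable (fun z : ℝ => gWeight Λ (Real.exp (K * z) / y)) volume
      (Real.log y / K - δ) (Real.log y / K + δ) := step_intervalIntegrable hΛ hK.le hy _ _
  have hanti : Antitone (fun z : ℝ => gWeight Λ (Real.exp (K * (2 * (Real.log y / K) - z)) / y)) :=
    fun a b hab => step_monotone hΛ hK.le hy (by linarith)
  have hint2 : IntervalIntegrable
      (fun z : ℝ => gWeight Λ (Real.exp (K * (2 * (Real.log y / K) - z)) / y)) volume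
      (Real.log y / K - δ) (Real.log y / K + δ) := hanti.intervalIntegrable
  have hrefl : ∫ z in (Real.log y / K - δ)..(Real.log y / K + δ),
      gWeight Λ (Real.exp (K * (2 * (Real.log y / K) - z)) / y) =
      ∫ z in (Real.log y / K - δ)..(Real.log y / K + δ), gWeight Λ (Real.exp (K * z) / y) := by
    rw [intervalIntegral.integral_comp_sub_left (fun z : ℝ => gWeight Λ (Real.exp (K * z) / y))
      (2 * (Real.log y / K))]
    congr 1 <;> ring
  have hone : ∫ z in (Real.log y / K - δ)..(Real.log y / K + δ),
      (gWeight Λ (Real.exp (K * z) / y) +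
        gWeight Λ (Real.exp (K * (2 * (Real.log y / K) - z)) / y)) = 2 * δ := by
    have : (fun z : ℝ => gWeight Λ (Real.exp (K * z) / y) +
        gWeight Λ (Real.exp (K * (2 * (Real.log y / K) - z)) / y)) = fun _ => (1 : ℝ) := by
      funext z; exact step_add_step_reflect hΛ hK.ne' hy z
    rw [this, intervalIntegral.integral_const, smul_eq_mul, mul_one]; ring
  rw [intervalIntegral.integral_add hint hint2, hrefl] at hone
  linarith

/-- To the RIGHT of the step (`u ≤ a ≤ b`): `0 ≤ (b − a) − ∫_a^b φ ≤ ∫_a^b γ`.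
[cite: Zhang2022LandauSiegel, §11 p. 63] -/
theorem integral_right_bounds (hΛ : 0 < Λ) (hK : 0 < K) (hy : 0 < y) {a b : ℝ}
    (hua : Real.log y / K ≤ a) (hab : a ≤ b) :
    0 ≤ (b - a) - ∫ z in a..b, gWeight Λ (Real.exp (K * z) / y) ∧
      (b - a) - ∫ z in a..b, gWeight Λ (Real.exp (K * z) / y) ≤
        ∫ z in a..b, (1 / 2) * Real.exp (-Λ * (K * z - Real.log y) ^ 2) := by
  have hφ := step_intervalIntegrable hΛ hK.le hy a b
  have hγ := majorant_intervalIntegrable (Λ := Λ) (K := K) (y := y) a b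
  have h1 : ∫ z in a..b, gWeight Λ (Real.exp (K * z) / y) ≤ ∫ _ in a..b, (1 : ℝ) :=
    intervalIntegral.integral_mono_on hab hφ intervalIntegrable_const
      (fun z _ => (gWeight_lt_one hΛ _).le)
  have h2 : ∫ z in a..b, ((1 : ℝ) - (1 / 2) * Real.exp (-Λ * (K * z - Real.log y) ^ 2)) ≤
      ∫ z in a..b, gWeight Λ (Real.exp (K * z) / y) :=
    intervalIntegral.integral_mono_on hab (intervalIntegrable_const.sub hγ) hφ
      (fun z hz => by linarith [(one_sub_step_bounds hΛ hK hy (le_trans hua hz.1)).2])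
  rw [intervalIntegral.integral_sub intervalIntegrable_const hγ, intervalIntegral.integral_const,
    smul_eq_mul, mul_one] at h2
  rw [intervalIntegral.integral_const, smul_eq_mul, mul_one] at h1
  exact ⟨by linarith, by linarith⟩

/-- To the LEFT of the step (`a ≤ b ≤ u`): `0 ≤ ∫_a^b φ ≤ ∫_a^b γ`.
[cite: Zhang2022LandauSiegel, §11 p. 63] -/
theorem integral_left_bounds (hΛ : 0 < Λ) (hK : 0 < K) (hy : 0 < y) {a b : ℝ}
    (hab : a ≤ b) (hbu : b ≤ Real.log y / K) :
    0 ≤ ∫ z in a..b, gWeight Λ (Real.exp (K * z) / y) ∧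
      ∫ z in a..b, gWeight Λ (Real.exp (K * z) / y) ≤
        ∫ z in a..b, (1 / 2) * Real.exp (-Λ * (K * z - Real.log y) ^ 2) := by
  have hφ := step_intervalIntegrable hΛ hK.le hy a b
  refine ⟨intervalIntegral.integral_nonneg hab (fun z _ => (gWeight_pos hΛ _).le), ?_⟩
  exact intervalIntegral.integral_mono_on hab hφ (majorant_intervalIntegrable a b)
    (fun z hz => step_le_majorant hΛ hK hy (le_trans hz.2 hbu))

/-- `γ` decreases to the right of `u`. [folklore] -/
private theorem majorant_le_of_right (hΛ : 0 ≤ Λ) (hK : 0 < K) {a z : ℝ} (hua : Real.log y / K ≤ a)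
    (haz : a ≤ z) :
    (1 / 2) * Real.exp (-Λ * (K * z - Real.log y) ^ 2) ≤
      (1 / 2) * Real.exp (-Λ * (K * a - Real.log y) ^ 2) := by
  have hu : Real.log y ≤ K * a := by rw [mul_comm]; exact (div_le_iff₀ hK).mp hua
  have h0 : 0 ≤ K * a - Real.log y := by linarith
  have h1 : K * a - Real.log y ≤ K * z - Real.log y := by nlinarith
  have h2 : (K * a - Real.log y) ^ 2 ≤ (K * z - Real.log y) ^ 2 := pow_le_pow_left₀ h0 h1 2
  have h3 : -Λ * (K * z - Real.log y) ^ 2 ≤ -Λ * (K * a - Real.log y) ^ 2 := by nlinarith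
  exact mul_le_mul_of_nonneg_left (Real.exp_le_exp.mpr h3) (by norm_num)

/-- `γ` increases to the left of `u`. [folklore] -/
private theorem majorant_le_of_left (hΛ : 0 ≤ Λ) (hK : 0 < K) {b z : ℝ} (hbu : b ≤ Real.log y / K)
    (hzb : z ≤ b) :
    (1 / 2) * Real.exp (-Λ * (K * z - Real.log y) ^ 2) ≤
      (1 / 2) * Real.exp (-Λ * (K * b - Real.log y) ^ 2) := by
  have hu : K * b ≤ Real.log y := by rw [mul_comm]; exact (le_div_iff₀ hK).mp hbu
  have h0 : 0 ≤ Real.log y - K * b := by linarith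
  have h1 : Real.log y - K * b ≤ Real.log y - K * z := by nlinarith
  have h2 : (Real.log y - K * b) ^ 2 ≤ (Real.log y - K * z) ^ 2 := pow_le_pow_left₀ h0 h1 2
  have e1 : (K * z - Real.log y) ^ 2 = (Real.log y - K * z) ^ 2 := by ring
  have e2 : (K * b - Real.log y) ^ 2 = (Real.log y - K * b) ^ 2 := by ring
  rw [e1, e2]
  have h3 : -Λ * (Real.log y - K * z) ^ 2 ≤ -Λ * (Real.log y - K * b) ^ 2 := by nlinarith
  exact mul_le_mul_of_nonneg_left (Real.exp_le_exp.mpr h3) (by norm_num)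

/-- `∫_a^b γ ≤ (b − a)γ(a)` to the right of `u`. [folklore] -/
private theorem integral_majorant_le_of_right (hΛ : 0 ≤ Λ) (hK : 0 < K) {a b : ℝ}
    (hua : Real.log y / K ≤ a) (hab : a ≤ b) :
    ∫ z in a..b, (1 / 2) * Real.exp (-Λ * (K * z - Real.log y) ^ 2) ≤
      (b - a) * ((1 / 2) * Real.exp (-Λ * (K * a - Real.log y) ^ 2)) := by
  have h := intervalIntegral.integral_mono_on hab (majorant_intervalIntegrable a b)
    intervalIntegrable_const (fun z hz => majorant_le_of_right hΛ hK hua hz.1)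
  rwa [intervalIntegral.integral_const, smul_eq_mul] at h

/-- `∫_a^b γ ≤ (b − a)γ(b)` to the left of `u`. [folklore] -/
private theorem integral_majorant_le_of_left (hΛ : 0 ≤ Λ) (hK : 0 < K) {a b : ℝ} (hab : a ≤ b)
    (hbu : b ≤ Real.log y / K) :
    ∫ z in a..b, (1 / 2) * Real.exp (-Λ * (K * z - Real.log y) ^ 2) ≤
      (b - a) * ((1 / 2) * Real.exp (-Λ * (K * b - Real.log y) ^ 2)) := by
  have h := intervalIntegral.integral_mono_on hab (majorant_intervalIntegrable a b)
    intervalIntegrable_const (fun z hz => majorant_le_of_left hΛ hK hbu hz.2)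
  rwa [intervalIntegral.integral_const, smul_eq_mul] at h

/-- **The Gaussian integral**: `∫_a^b γ ≤ ½√(π/(ΛK²))` in every position (the estimate behind
(11.3)). [cite: Zhang2022LandauSiegel, §11 (11.3) p. 64] -/
theorem integral_majorant_le_gaussian (hΛ : 0 < Λ) (hK : 0 < K) {a b : ℝ} (hab : a ≤ b) :
    ∫ z in a..b, (1 / 2) * Real.exp (-Λ * (K * z - Real.log y) ^ 2) ≤
      (1 / 2) * Real.sqrt (π / (Λ * K ^ 2)) := by
  have hΛK : 0 < Λ * K ^ 2 := by positivity
  have hfun : (fun z : ℝ => (1 / 2) * Real.exp (-Λ * (K * z - Real.log y) ^ 2)) =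
      fun z => (1 / 2) * Real.exp (-(Λ * K ^ 2) * (z - Real.log y / K) ^ 2) := by
    funext z
    have : K * z - Real.log y = K * (z - Real.log y / K) := by
      rw [mul_sub, mul_div_cancel₀ _ hK.ne']
    rw [this]
    congr 2
    ring
  have hint : Integrable (fun z : ℝ => Real.exp (-(Λ * K ^ 2) * (z - Real.log y / K) ^ 2)) :=
    (integrable_exp_neg_mul_sq hΛK).comp_sub_right (Real.log y / K)
  rw [hfun, intervalIntegral.integral_of_le hab, integral_const_mul]
  gcongr
  calc ∫ z in Ioc a b, Real.exp (-(Λ * K ^ 2) * (z - Real.log y / K) ^ 2)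
      ≤ ∫ z, Real.exp (-(Λ * K ^ 2) * (z - Real.log y / K) ^ 2) :=
        setIntegral_le_integral hint (Eventually.of_forall fun z => (Real.exp_pos _).le)
    _ = ∫ z, Real.exp (-(Λ * K ^ 2) * z ^ 2) :=
        integral_sub_right_eq_self (fun z => Real.exp (-(Λ * K ^ 2) * z ^ 2)) (Real.log y / K)
    _ = Real.sqrt (π / (Λ * K ^ 2)) := integral_gaussian _

/-- **Uniform position lemma**: for every `a ≤ b` and every `y > 0`,
`|∫_a^b φ − (b − clamp(u;a,b))| ≤ ½√(π/(ΛK²))`, `clamp(u;a,b) = max a (min u b)`, `u = log y/K`.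
[cite: Zhang2022LandauSiegel, §11 p. 64] -/
theorem integral_step_crude (hΛ : 0 < Λ) (hK : 0 < K) (hy : 0 < y) {a b : ℝ} (hab : a ≤ b) :
    |(∫ z in a..b, gWeight Λ (Real.exp (K * z) / y)) - (b - max a (min (Real.log y / K) b))| ≤
      (1 / 2) * Real.sqrt (π / (Λ * K ^ 2)) := by
  have hI := step_intervalIntegrable hΛ hK.le hy
  rcases le_total (Real.log y / K) a with hua | hau
  · have hclamp : max a (min (Real.log y / K) b) = a :=
      max_eq_left (le_trans (min_le_left _ _) hua)
    rw [hclamp]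
    obtain ⟨h1, h2⟩ := integral_right_bounds hΛ hK hy hua hab
    have h3 := integral_majorant_le_gaussian (y := y) hΛ hK hab
    rw [abs_le]; constructor <;> linarith
  · rcases le_total (Real.log y / K) b with hub | hbu
    · have hclamp : max a (min (Real.log y / K) b) = Real.log y / K := by
        rw [min_eq_left hub, max_eq_right hau]
      rw [hclamp]
      obtain ⟨l1, l2⟩ := integral_left_bounds hΛ hK hy hau le_rfl
      obtain ⟨r1, r2⟩ := integral_right_bounds hΛ hK hy le_rfl hub
      have g1 := integral_majorant_le_gaussian (y := y) hΛ hK hau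
      have g2 := integral_majorant_le_gaussian (y := y) hΛ hK hub
      have hsplit : ∫ z in a..b, gWeight Λ (Real.exp (K * z) / y) =
          (∫ z in a..(Real.log y / K), gWeight Λ (Real.exp (K * z) / y)) +
            ∫ z in (Real.log y / K)..b, gWeight Λ (Real.exp (K * z) / y) :=
        (intervalIntegral.integral_add_adjacent_intervals (hI _ _) (hI _ _)).symm
      rw [hsplit, abs_le]; constructor <;> linarith
    · have hclamp : max a (min (Real.log y / K) b) = b := by
        rw [min_eq_right hbu, max_eq_right hab]
      rw [hclamp, sub_self, sub_zero]
      obtain ⟨l1, l2⟩ := integral_left_bounds hΛ hK hy hab hbu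
      have g1 := integral_majorant_le_gaussian (y := y) hΛ hK hab
      rw [abs_le]; constructor <;> linarith

/-- **Middle position with margin `δ`** (`a ≤ u − δ`, `u + δ ≤ b`):
`|∫_a^b φ − (b − u)| ≤ (b − a)·½exp{−Λ(Kδ)²}` (exact window + (4.2)/(4.3) tails).
[cite: Zhang2022LandauSiegel, §11 p. 63] -/
theorem integral_step_middle (hΛ : 0 < Λ) (hK : 0 < K) (hy : 0 < y) {a b δ : ℝ} (hδ : 0 ≤ δ)
    (ha : a ≤ Real.log y / K - δ) (hb : Real.log y / K + δ ≤ b) :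
    |(∫ z in a..b, gWeight Λ (Real.exp (K * z) / y)) - (b - Real.log y / K)| ≤
      (b - a) * ((1 / 2) * Real.exp (-Λ * (K * δ) ^ 2)) := by
  have hI := step_intervalIntegrable hΛ hK.le hy
  have hsplit : ∫ z in a..b, gWeight Λ (Real.exp (K * z) / y) =
      (∫ z in a..(Real.log y / K - δ), gWeight Λ (Real.exp (K * z) / y)) +
        (∫ z in (Real.log y / K - δ)..(Real.log y / K + δ), gWeight Λ (Real.exp (K * z) / y)) +
        ∫ z in (Real.log y / K + δ)..b, gWeight Λ (Real.exp (K * z) / y) := by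
    rw [intervalIntegral.integral_add_adjacent_intervals (hI _ _) (hI _ _),
      intervalIntegral.integral_add_adjacent_intervals (hI _ _) (hI _ _)]
  rw [hsplit, integral_step_symm hΛ hK hy δ]
  obtain ⟨l1, l2⟩ := integral_left_bounds hΛ hK hy ha (by linarith : Real.log y / K - δ ≤ _)
  obtain ⟨r1, r2⟩ := integral_right_bounds hΛ hK hy (by linarith : _ ≤ Real.log y / K + δ) hb
  have gl := integral_majorant_le_of_left hΛ.le hK (y := y) ha (by linarith)
  have gr := integral_majorant_le_of_right hΛ.le hK (y := y) (b := b) (by linarith) hb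
  have e1 : (K * (Real.log y / K - δ) - Real.log y) ^ 2 = (K * δ) ^ 2 := by
    rw [mul_sub, mul_div_cancel₀ _ hK.ne']; ring
  have e2 : (K * (Real.log y / K + δ) - Real.log y) ^ 2 = (K * δ) ^ 2 := by
    rw [mul_add, mul_div_cancel₀ _ hK.ne']; ring
  rw [e1] at gl
  rw [e2] at gr
  have hE : 0 ≤ (1 / 2) * Real.exp (-Λ * (K * δ) ^ 2) := by positivity
  have m1 : (Real.log y / K - δ - a) * ((1 / 2) * Real.exp (-Λ * (K * δ) ^ 2)) ≤
      (b - a) * ((1 / 2) * Real.exp (-Λ * (K * δ) ^ 2)) :=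
    mul_le_mul_of_nonneg_right (by linarith) hE
  have m2 : (b - (Real.log y / K + δ)) * ((1 / 2) * Real.exp (-Λ * (K * δ) ^ 2)) ≤
      (b - a) * ((1 / 2) * Real.exp (-Λ * (K * δ) ^ 2)) :=
    mul_le_mul_of_nonneg_right (by linarith) hE
  rw [abs_le]; constructor <;> linarith

/-- **Far-right position** (`u + δ ≤ a ≤ b`, `δ ≥ 0`): `|∫_a^b φ − (b − a)| ≤ (b − a)·½exp{−Λ(Kδ)²}`.
[cite: Zhang2022LandauSiegel, §11 p. 63] -/
theorem integral_step_right_far (hΛ : 0 < Λ) (hK : 0 < K) (hy : 0 < y) {a b δ : ℝ} (hδ : 0 ≤ δ)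
    (ha : Real.log y / K + δ ≤ a) (hab : a ≤ b) :
    |(∫ z in a..b, gWeight Λ (Real.exp (K * z) / y)) - (b - a)| ≤
      (b - a) * ((1 / 2) * Real.exp (-Λ * (K * δ) ^ 2)) := by
  obtain ⟨r1, r2⟩ := integral_right_bounds hΛ hK hy (by linarith : Real.log y / K ≤ a) hab
  have gr := integral_majorant_le_of_right hΛ.le hK (y := y) (by linarith : Real.log y / K ≤ a) hab
  have hga : (1 / 2) * Real.exp (-Λ * (K * a - Real.log y) ^ 2) ≤
      (1 / 2) * Real.exp (-Λ * (K * δ) ^ 2) := by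
    have h := majorant_le_of_right hΛ.le hK (y := y) (a := Real.log y / K + δ) (z := a)
      (by linarith) ha
    have e2 : (K * (Real.log y / K + δ) - Real.log y) ^ 2 = (K * δ) ^ 2 := by
      rw [mul_add, mul_div_cancel₀ _ hK.ne']; ring
    rw [e2] at h
    exact h
  have hE := mul_le_mul_of_nonneg_left hga (by linarith : 0 ≤ b - a)
  rw [abs_le]; constructor <;> linarith

/-- **Far-left position** (`a ≤ b ≤ u − δ`, `δ ≥ 0`): `|∫_a^b φ| ≤ (b − a)·½exp{−Λ(Kδ)²}`.
[cite: Zhang2022LandauSiegel, §11 p. 63] -/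
theorem integral_step_left_far (hΛ : 0 < Λ) (hK : 0 < K) (hy : 0 < y) {a b δ : ℝ} (hδ : 0 ≤ δ)
    (hab : a ≤ b) (hb : b ≤ Real.log y / K - δ) :
    |∫ z in a..b, gWeight Λ (Real.exp (K * z) / y)| ≤
      (b - a) * ((1 / 2) * Real.exp (-Λ * (K * δ) ^ 2)) := by
  obtain ⟨l1, l2⟩ := integral_left_bounds hΛ hK hy hab (by linarith : b ≤ Real.log y / K)
  have gl := integral_majorant_le_of_left hΛ.le hK (y := y) hab (by linarith : b ≤ Real.log y / K)
  have hgb : (1 / 2) * Real.exp (-Λ * (K * b - Real.log y) ^ 2) ≤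
      (1 / 2) * Real.exp (-Λ * (K * δ) ^ 2) := by
    have h := majorant_le_of_left hΛ.le hK (y := y) (b := Real.log y / K - δ) (z := b)
      (by linarith) hb
    have e1 : (K * (Real.log y / K - δ) - Real.log y) ^ 2 = (K * δ) ^ 2 := by
      rw [mul_sub, mul_div_cancel₀ _ hK.ne']; ring
    rw [e1] at h
    exact h
  have hE := mul_le_mul_of_nonneg_left hgb (by linarith : 0 ≤ b - a)
  rw [abs_le]; constructor <;> linarith

end Literature.NumberTheory.LFunctions.Zhang2022.SmoothedStep
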